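import Summits.RiemannHypothesis.RiemannHypothesis.Theorems.SignConeOscCoherentCoreStubDefectLowerBound
import Summits.RiemannHypothesis.RiemannHypothesis.Theorems.SignConeOscCoherentCoreStubDefectSpectral
import Summits.RiemannHypothesis.RiemannHypothesis.Theorems.SignConeOscCoherentCoreStubCutoffKernelBound
import Summits.RiemannHypothesis.RiemannHypothesis.Theorems.SignConeOscCoherentCoreStubWindowSum
import Literature.NumberTheory.LFunctions.WeilExplicitFormulaProofs
import Literature.NumberTheory.LFunctions.WeilArchimedeanMoments

/-!
# `SignCone.OscCoherentCore`, line `Sketch` — stub E: the TRANSFER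
(item stmt-RiemannHypothesis-18013, route route-RiemannHypothesis-SignCone; `--supports`)

The windowed off-line second-moment law for the zeros of `ζ` at cutoff `a ≥ 1`,
`Σ_{|Im ρ - t| ≤ 1/a} m(ρ) (Re ρ - 1/2)² ≤ κ(a) := 1/(400 (2a+1)³ cosh(a+1/2) (a+1))` in every height window,
implies UNIT-SLACK WEIL POSITIVITY at cutoff `a`: `-‖g‖₂² ≤ Re W(g ⋆ g̃)` for every Weil test `g` supported in
`[-a, a]`.  Composition of the four landed stubs of the line:

* `stub_defectLowerBound` (A): `m(ρ) Re k̂(ρ) ≥ -½ m(ρ) |D_k(ρ)|`, `k = g ⋆ g̃`,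
  `D_k(ρ) = ∫ k(u)(2cosh(δu) - 2)e^{iγu} du`, `δ = Re ρ - 1/2`, `γ = Im ρ`;
* `stub_defectSpectral` (B): `D_k(ρ) = (1/2π) ∫ |ĝ(1/2+iξ)|² L̂_{a,δ}(γ - ξ) dξ`;
* `stub_cutoffKernelBound` (C): `|L̂_{a,δ}(η)| ≤ δ² E(a)/(1+η²)`, `E(a) = 200(2a+1)³cosh(a+1/2)`;
* `stub_windowSum` (D): `Σ_{ρ ∈ weilZeroIndex T} m(ρ) δ_ρ²/(1+(γ_ρ-ξ)²) ≤ κ(a)(4a+4)`;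

with Plancherel `∫ |ĝ(1/2+iξ)|² dξ = 2π ‖g‖₂²` (`integral_norm_sq_weilMellin_half_line`) and the explicit formula
`W(g ⋆ g̃) = lim_T Σ_{ρ ∈ weilZeroIndex T} m(ρ) k̂(ρ)` (`explicit_formula_holds`): for every `T`,
`Re Σ_ρ m(ρ) k̂(ρ) ≥ -(E(a)/4π) ∫ |ĝ|² Σ_ρ m δ²/(1+(γ-ξ)²) ≥ -(E(a) κ(a) (4a+4)/4π) · 2π‖g‖₂² = -‖g‖₂²`.
-/

noncomputable section

-- `Summit.RiemannHypothesis.RiemannHypothesis.…` repeats a namespace component by design (D-0017 layout).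
set_option linter.dupNamespace false

open scoped BigOperators ComplexConjugate Real Topology
open Complex MeasureTheory Set Filter

namespace Summit.RiemannHypothesis.RiemannHypothesis.Theorems.OscCoherentCore

open Literature.NumberTheory.LFunctions

/-- Integrability of the Cauchy-weighted spectral density `ξ ↦ ‖ĝ(1/2+iξ)‖² · c/(1 + (γ - ξ)²)` (`c ≥ 0`).
[folklore] -/
theorem integrable_norm_sq_weilMellin_mul_cauchyWeight {g : ℝ → ℂ} (hg : IsWeilTest g) {c : ℝ}
    (hc : 0 ≤ c) (γ : ℝ) :
    Integrable fun ξ : ℝ => ‖weilMellin g (1 / 2 + ξ * I)‖ ^ 2 * (c / (1 + (γ - ξ) ^ 2)) := by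
  refine integrable_norm_sq_weilMellin_mul hg (by fun_prop) hc le_rfl (B := 0) fun t => ?_
  have hpos : 0 < 1 + (γ - t) ^ 2 := by positivity
  rw [abs_of_nonneg (div_nonneg hc hpos.le), zero_mul, add_zero]
  exact div_le_self hc (by nlinarith [sq_nonneg (γ - t)])

/-- **Per-zero bound.** For a Weil test `g` supported in `[-a, a]` (`a ≥ 1`), `k = g ⋆ g̃`, and `ρ` with
`0 ≤ Re ρ ≤ 1`, `Im ρ ≠ 0`:
`-(E(a)/4π) ∫ ‖ĝ(1/2+iξ)‖² · m(ρ)(Re ρ - 1/2)²/(1 + (Im ρ - ξ)²) dξ ≤ m(ρ) Re k̂(ρ)`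
(stubs A, B, C of the line). [folklore] -/
theorem zeroTerm_re_ge {a : ℝ} (ha : 1 ≤ a) {g : ℝ → ℂ} (hg : IsWeilTest g)
    (hsupp : tsupport g ⊆ Icc (-a) a) {ρ : ℂ} (h0 : 0 ≤ ρ.re) (h1 : ρ.re ≤ 1) (him : ρ.im ≠ 0) :
    -(200 * (2 * a + 1) ^ 3 * Real.cosh (a + 1 / 2) / (4 * π)) *
        ∫ ξ : ℝ, ‖weilMellin g (1 / 2 + ξ * I)‖ ^ 2 *
          ((riemannZetaZeroOrder ρ : ℝ) * (ρ.re - 1 / 2) ^ 2 / (1 + (ρ.im - ξ) ^ 2)) ≤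
      (riemannZetaZeroOrder ρ : ℝ) * (weilMellin (weilConv g (weilReflect g)) ρ).re := by
  have hne : ρ ≠ 1 := by
    rintro rfl
    simp at him
  have hm0 : (0 : ℝ) ≤ riemannZetaZeroOrder ρ := by exact_mod_cast riemannZetaZeroOrder_nonneg hne
  have hδ : |ρ.re - 1 / 2| ≤ 1 / 2 := abs_le.2 ⟨by linarith, by linarith⟩
  have hE0 : 0 ≤ 200 * (2 * a + 1) ^ 3 * Real.cosh (a + 1 / 2) := by
    have := Real.cosh_pos (a + 1 / 2)
    positivity
  -- (A)
  have hA := stub_defectLowerBound g hg ρ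
  -- (B) + (C): bound the norm of the defect
  have hB := stub_defectSpectral a (by linarith) g hg hsupp (ρ.re - 1 / 2) ρ.im
  set J : ℝ := ∫ ξ : ℝ, ‖weilMellin g (1 / 2 + ξ * I)‖ ^ 2 *
    ((ρ.re - 1 / 2) ^ 2 * (200 * (2 * a + 1) ^ 3 * Real.cosh (a + 1 / 2)) / (1 + (ρ.im - ξ) ^ 2)) with hJ
  have hD : ‖∫ u : ℝ, weilConv g (weilReflect g) u *
      ((2 * Real.cosh ((ρ.re - 1 / 2) * u) - 2 : ℝ) : ℂ) * cexp (↑(ρ.im * u) * I)‖ ≤ 1 / (2 * π) * J := by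
    rw [hB, norm_mul]
    have h2π : ‖(1 / (2 * π) : ℂ)‖ = 1 / (2 * π) := by
      rw [show (1 / (2 * π) : ℂ) = ((1 / (2 * π) : ℝ) : ℂ) by push_cast; rfl, Complex.norm_real,
        Real.norm_eq_abs, abs_of_pos (by positivity)]
    rw [h2π]
    refine mul_le_mul_of_nonneg_left ?_ (by positivity)
    rw [hJ]
    refine norm_integral_le_of_norm_le
      (integrable_norm_sq_weilMellin_mul_cauchyWeight hg (by positivity) ρ.im)
      (Eventually.of_forall fun ξ => ?_)
    rw [norm_mul, Complex.norm_real, Real.norm_eq_abs, abs_of_nonneg (sq_nonneg _)]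
    refine mul_le_mul_of_nonneg_left ?_ (sq_nonneg _)
    exact stub_cutoffKernelBound a ha (ρ.re - 1 / 2) hδ (ρ.im - ξ)
  -- rescale the weighted integral
  have hJ' : (∫ ξ : ℝ, ‖weilMellin g (1 / 2 + ξ * I)‖ ^ 2 *
      ((riemannZetaZeroOrder ρ : ℝ) * (ρ.re - 1 / 2) ^ 2 / (1 + (ρ.im - ξ) ^ 2))) =
      (riemannZetaZeroOrder ρ : ℝ) / (200 * (2 * a + 1) ^ 3 * Real.cosh (a + 1 / 2)) * J := by
    rw [hJ, ← integral_const_mul]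
    refine integral_congr_ae (Eventually.of_forall fun ξ => ?_)
    have hEpos : 0 < 200 * (2 * a + 1) ^ 3 * Real.cosh (a + 1 / 2) := by
      have := Real.cosh_pos (a + 1 / 2)
      positivity
    field_simp
  rw [hJ']
  have h1 : -(1 / 2 : ℝ) * (1 / (2 * π) * J) ≤ (weilMellin (weilConv g (weilReflect g)) ρ).re := by
    linarith [hA, hD]
  have h2 := mul_le_mul_of_nonneg_left h1 hm0
  have hEpos : 0 < 200 * (2 * a + 1) ^ 3 * Real.cosh (a + 1 / 2) := by
    have := Real.cosh_pos (a + 1 / 2)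
    positivity
  have hπ : (π : ℝ) ≠ 0 := Real.pi_ne_zero
  calc -(200 * (2 * a + 1) ^ 3 * Real.cosh (a + 1 / 2) / (4 * π)) *
        ((riemannZetaZeroOrder ρ : ℝ) / (200 * (2 * a + 1) ^ 3 * Real.cosh (a + 1 / 2)) * J)
        = (riemannZetaZeroOrder ρ : ℝ) * (-(1 / 2 : ℝ) * (1 / (2 * π) * J)) := by
          field_simp
          ring
    _ ≤ (riemannZetaZeroOrder ρ : ℝ) * (weilMellin (weilConv g (weilReflect g)) ρ).re := h2

/-- **Per-height bound.** Under the window law at cutoff `a ≥ 1` with constant `κ(a)`, every truncated zero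
side of the explicit formula for `k = g ⋆ g̃` (`g` a Weil test supported in `[-a, a]`) has real part at least
`-‖g‖₂²`. [folklore] -/
theorem neg_weilNorm_le_re_weilZeroSidePartial {a : ℝ} (ha : 1 ≤ a)
    (hlaw : ∀ (t : ℝ) (S : Finset ℂ),
      (∀ ρ ∈ S, riemannZeta ρ = 0 ∧ 0 ≤ ρ.re ∧ ρ.re ≤ 1 ∧ ρ.im ≠ 0 ∧ |ρ.im - t| ≤ 1 / a) →
      ∑ ρ ∈ S, (riemannZetaZeroOrder ρ : ℝ) * (ρ.re - 1 / 2) ^ 2 ≤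
        1 / (400 * (2 * a + 1) ^ 3 * Real.cosh (a + 1 / 2) * (a + 1)))
    {g : ℝ → ℂ} (hg : IsWeilTest g) (hsupp : tsupport g ⊆ Icc (-a) a) (T : ℝ) :
    -(∫ t : ℝ, ‖g t‖ ^ 2) ≤ (weilZeroSidePartial (weilConv g (weilReflect g)) T).re := by
  have hfin := weilZeroIndex_finite T
  have hEpos : 0 < 200 * (2 * a + 1) ^ 3 * Real.cosh (a + 1 / 2) := by
    have := Real.cosh_pos (a + 1 / 2)
    positivity
  have hκ0 : (0 : ℝ) ≤ 1 / (400 * (2 * a + 1) ^ 3 * Real.cosh (a + 1 / 2) * (a + 1)) := by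
    have := Real.cosh_pos (a + 1 / 2)
    positivity
  have hmem : ∀ ρ ∈ hfin.toFinset, riemannZeta ρ = 0 ∧ 0 ≤ ρ.re ∧ ρ.re ≤ 1 ∧ ρ.im ≠ 0 ∧ |ρ.im| ≤ T :=
    fun ρ hρ => by simpa [weilZeroIndex] using hρ
  -- the partial zero side as a finite sum of real parts
  have hre : (weilZeroSidePartial (weilConv g (weilReflect g)) T).re =
      ∑ ρ ∈ hfin.toFinset, (riemannZetaZeroOrder ρ : ℝ) *
        (weilMellin (weilConv g (weilReflect g)) ρ).re := by
    unfold weilZeroSidePartial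
    rw [finsum_mem_eq_finite_toFinset_sum _ hfin, Complex.re_sum]
    refine Finset.sum_congr rfl fun ρ _ => ?_
    rw [← Complex.ofReal_intCast, Complex.re_ofReal_mul]
  rw [hre]
  -- the window sum (stub D), as a finite sum
  have hDS : ∀ ξ : ℝ, ∑ ρ ∈ hfin.toFinset,
      (riemannZetaZeroOrder ρ : ℝ) * (ρ.re - 1 / 2) ^ 2 / (1 + (ρ.im - ξ) ^ 2) ≤
        1 / (400 * (2 * a + 1) ^ 3 * Real.cosh (a + 1 / 2) * (a + 1)) * (4 * a + 4) := by
    intro ξ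
    have h := stub_windowSum a _ ha hκ0 hlaw ξ T
    rwa [finsum_mem_eq_finite_toFinset_sum _ hfin] at h
  -- integrability of the weighted spectral densities
  have hInt : ∀ ρ ∈ hfin.toFinset, Integrable fun ξ : ℝ => ‖weilMellin g (1 / 2 + ξ * I)‖ ^ 2 *
      ((riemannZetaZeroOrder ρ : ℝ) * (ρ.re - 1 / 2) ^ 2 / (1 + (ρ.im - ξ) ^ 2)) := by
    intro ρ hρ
    obtain ⟨-, -, -, him, -⟩ := hmem ρ hρ
    have hne : ρ ≠ 1 := by
      rintro rfl
      simp at him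
    have hm0 : (0 : ℝ) ≤ riemannZetaZeroOrder ρ := by exact_mod_cast riemannZetaZeroOrder_nonneg hne
    exact integrable_norm_sq_weilMellin_mul_cauchyWeight hg (by positivity) ρ.im
  -- Plancherel
  have hPl := integral_norm_sq_weilMellin_half_line hg
  have hπ : (π : ℝ) ≠ 0 := Real.pi_ne_zero
  have ha1 : (0 : ℝ) < a + 1 := by linarith
  calc -(∫ t : ℝ, ‖g t‖ ^ 2)
      = -(200 * (2 * a + 1) ^ 3 * Real.cosh (a + 1 / 2) / (4 * π)) *
          ∫ ξ : ℝ, ‖weilMellin g (1 / 2 + ξ * I)‖ ^ 2 *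
            (1 / (400 * (2 * a + 1) ^ 3 * Real.cosh (a + 1 / 2) * (a + 1)) * (4 * a + 4)) := by
        rw [integral_mul_const, hPl, weilNorm2Sq]
        field_simp
        ring
    _ ≤ -(200 * (2 * a + 1) ^ 3 * Real.cosh (a + 1 / 2) / (4 * π)) *
          ∫ ξ : ℝ, ‖weilMellin g (1 / 2 + ξ * I)‖ ^ 2 *
            ∑ ρ ∈ hfin.toFinset,
              (riemannZetaZeroOrder ρ : ℝ) * (ρ.re - 1 / 2) ^ 2 / (1 + (ρ.im - ξ) ^ 2) := by
        rw [neg_mul, neg_mul, neg_le_neg_iff]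
        refine mul_le_mul_of_nonneg_left ?_ (by positivity)
        refine integral_mono ?_ ?_ fun ξ => ?_
        · simp_rw [Finset.mul_sum]
          exact integrable_finsetSum _ hInt
        · exact (integrable_norm_sq_weilMellin_half_line hg).mul_const _
        · exact mul_le_mul_of_nonneg_left (hDS ξ) (sq_nonneg _)
    _ = ∑ ρ ∈ hfin.toFinset, -(200 * (2 * a + 1) ^ 3 * Real.cosh (a + 1 / 2) / (4 * π)) *
          ∫ ξ : ℝ, ‖weilMellin g (1 / 2 + ξ * I)‖ ^ 2 *
            ((riemannZetaZeroOrder ρ : ℝ) * (ρ.re - 1 / 2) ^ 2 / (1 + (ρ.im - ξ) ^ 2)) := by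
        rw [← Finset.mul_sum, ← integral_finsetSum _ hInt]
        congr 1
        refine integral_congr_ae (Eventually.of_forall fun ξ => ?_)
        simp only [Finset.mul_sum]
    _ ≤ ∑ ρ ∈ hfin.toFinset, (riemannZetaZeroOrder ρ : ℝ) *
          (weilMellin (weilConv g (weilReflect g)) ρ).re := by
        refine Finset.sum_le_sum fun ρ hρ => ?_
        obtain ⟨-, h0, h1, him, -⟩ := hmem ρ hρ
        exact zeroTerm_re_ge ha hg hsupp h0 h1 him

/-- STUB E (transfer; lead). The windowed off-line second-moment law at cutoff `a ≥ 1` with constant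
`κ(a) = 1/(400 (2a+1)³ cosh(a+1/2) (a+1))` gives UNIT-SLACK WEIL POSITIVITY at cutoff `a`:
`-‖g‖₂² ≤ Re W(g ⋆ g̃)` for every Weil test `g` supported in `[-a, a]`. Proof: the explicit formula
(`explicit_formula_holds`) exhibits `W(g ⋆ g̃)` as the limit of the truncated zero sides, each of which has real
part `≥ -‖g‖₂²` (`neg_weilNorm_le_re_weilZeroSidePartial`: stubs A–D + Plancherel). [folklore] -/
theorem stub_transfer :
    ∀ a : ℝ, 1 ≤ a →
      (∀ (t : ℝ) (S : Finset ℂ),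
        (∀ ρ ∈ S, riemannZeta ρ = 0 ∧ 0 ≤ ρ.re ∧ ρ.re ≤ 1 ∧ ρ.im ≠ 0 ∧ |ρ.im - t| ≤ 1 / a) →
        ∑ ρ ∈ S, (riemannZetaZeroOrder ρ : ℝ) * (ρ.re - 1 / 2) ^ 2 ≤
          1 / (400 * (2 * a + 1) ^ 3 * Real.cosh (a + 1 / 2) * (a + 1))) →
      ∀ g : ℝ → ℂ, IsWeilTest g → tsupport g ⊆ Icc (-a) a →
        -(∫ t : ℝ, ‖g t‖ ^ 2) ≤ (weilQuadratic g).re := by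
  intro a ha hlaw g hg hsupp
  have hk : IsWeilTest (weilConv g (weilReflect g)) := hg.weilConv hg.weilReflect
  have hlim : Tendsto (fun T => (weilZeroSidePartial (weilConv g (weilReflect g)) T).re) atTop
      (𝓝 (weilQuadratic g).re) :=
    (Complex.continuous_re.tendsto _).comp (explicit_formula_holds hk)
  exact ge_of_tendsto' hlim fun T => neg_weilNorm_le_re_weilZeroSidePartial ha hlaw hg hsupp T

end Summit.RiemannHypothesis.RiemannHypothesis.Theorems.OscCoherentCore

end
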